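import Literature.NumberTheory.Automorphic.PairLFunctionPolesGLOneBoundaryUnconditional
import Literature.NumberTheory.Automorphic.PairLFunctionPolesGLOneDedekindProofs
import Summits.HodgeConjecture.HodgeConjecture.Theorems.K2LiuHeckeEulerProductRegular
import Summits.HodgeConjecture.HodgeConjecture.Theorems.K2LiuThetaTypePartialLPole

/-!
# K2_Liu_CurveThetaSigs — unit U1 «POLE INPUT» (tier-1 socket module for hLiu418 = stmt-HodgeConjecture-24832)

Track B ∕ build stream 29 (director s1813 naming rule: `Cruxes/HLiu418/Lines/K2_Liu_*`). Planner
`hodgecm-mathlib-K2Liu-plan` g0, 2026-09-03. INFO-ONLY companion to the #184♮ LINE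
`Cruxes/HLiu418/Lines/K2_Liu_CurveThetaNonOrthogonal.lean` (A-plan2 (g33), line writer of record):
this module files the `sig_` sockets of the first typeable files of the in-house road for
`Literature.NumberTheory.Automorphic.Liu2021.curveTheta_nonOrthogonal₂` along Liu 2021, Thm. B.4 (1)
(a)⇒(b)⇒(c) at `(n, s₀, μ) = (2, 1, λ⁻¹)` — see the squad memos
`K2/K2Liu-plan/g0/AUDIT-184nat-Liu2021-AppB-AppD.v1.K2Liu-plan-g0.md` (3652305f86989c28) and
`K2/K2Liu-plan/g0/DEPMAP-PRICE-184nat.v1.K2Liu-plan-g0.md` (b9277aeddb85c718), §4 FIRST 20 FILES.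

Unit U1 is the analytic half of seam s1∕s2 («θ-type ⇒ (a)»): for a θ-type `π` and `μ = λ⁻¹`,
`L^S(s, π × λ⁻¹) · L^S(2s, λ⁻¹, As⁺) = ζ^S_L(s) · L^S(s, ν) · L^S_{L⁺}(2s, η)`, `ν := λᶜ χ̌ λ⁻¹`
(unitary, trivial on `Δℝ_{>0}`), whose pole at `s₀ = 1` is GL₁ analysis over the tree's partial
Euler products (★ `tendsto_sub_one_mul_tprod_eulerFactor_one_numberField`,
★ `exists_entire_forall_ne_zero_eq_partialHeckeL`). One `theorem sig_<File> : ‹statement› := by sorry`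
per planned file; `<File>` = the exact basename a prover lands under `Theorems/`. No `def`, no
`instance`, no `notation`; statements over ★ carriers only. HONEST LABEL: HC_CM is proved only
modulo the 7 printed citations (2 remaining named inputs: hLiu418 = stmt-HodgeConjecture-24832,
h413 = stmt-HodgeConjecture-24833) until rung 0 closes; this module retires nothing by itself.

ED. 2 (2026-09-03, re-tie edition, LEAD F0P6-plan (g10) 20:45:16Z batching rule): both sockets of this unit are PAID — statement bytes
UNCHANGED, the `sorry` bodies replaced BY NAME by the landed theorems ★ `Theorems/K2LiuHeckeEulerProductRegular.lean` (K2Liu-p02 (g0))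
and ★ p854710 `Theorems/K2LiuThetaTypePartialLPole.lean` (K2Liu-p01 (g0)); the module is now sorry-free (the by-name terms are the tie
probes: they elaborate iff the landed types equal the socket bytes).
-/

noncomputable section

open scoped Topology NNReal
open NumberField IsDedekindDomain Filter Complex Set
open Literature.NumberTheory.GaloisRepresentations
open Literature.NumberTheory.Automorphic

namespace Summit.HodgeConjecture.HodgeConjecture.Cruxes.HLiu418.K2LiuCurveThetaSigsU1PoleInput

/-- socket #1 (U1) — **regularity of a unitary partial Euler product on `Re s > 1`**: for a unitary
Hecke character `ψ` of a number field `K` and a finite set `S` of finite places, the partial Euler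
product `s ↦ ∏'_{v ∉ S} (1 − ψ(ϖ_v) q_v^{−s})⁻¹` is continuous on `{Re s > 1}` and has no zero there
(used for the denominators `L^S(s+1, ·)`, `L^S(2s+1, ·)` of the constant-term ratio `r(s)` at `s = 1`).
[cite: Liu2021, Thm. B.4 (1)(a), p. 98]
audit: paper:liu2021-fourier-jacobi-cycles-arithmetic-relative-trace-formula p0098.txt:L18 «(a) LS (s, π × μ) · LS (2s, μ, As(−1)n ) has a pole at s0»
size S · deps: ★ `HeckeLFunctionAnalyticProofs.heckeLFunction_ne_zero`, ★ `GodementJacquetRankOneEntire.exists_entire_eq_partialHeckeL`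
(or absolute convergence directly) · road S-A and S-B · OWNER: open (first prover of the K2_Liu stream). -/
theorem sig_K2LiuHeckeEulerProductRegular :
    ∀ (K : Type) [Field K] [NumberField K] (ψ : HeckeCharacter K), ψ.IsUnitary →
      ∀ (S : Set (HeightOneSpectrum (𝓞 K))), S.Finite →
        ContinuousOn (fun s : ℂ => ∏' v : {v : HeightOneSpectrum (𝓞 K) // v ∉ S},
            (1 - ψ.valueAtUniformizer v.1 * ((v.1.residueCard : ℂ) ^ (-s)))⁻¹) {s : ℂ | 1 < s.re} ∧
          ∀ s : ℂ, 1 < s.re →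
            (∏' v : {v : HeightOneSpectrum (𝓞 K) // v ∉ S},
              (1 - ψ.valueAtUniformizer v.1 * ((v.1.residueCard : ℂ) ^ (-s)))⁻¹) ≠ 0 :=
  Summit.HodgeConjecture.HodgeConjecture.Cruxes.HLiu418.K2LiuHeckeEulerProductRegular.heckeEulerProductRegular

/-- socket #2 (U1) — **the pole at `s₀ = 1` of `ζ^S_K(s) · L^S(s, ψ)`** («(a) holds at `s₀ = 1` for
θ-type data», FIRST RUNG of the K2_Liu road): for a unitary Hecke character `ψ` of `K` trivial on
the diagonal positive reals (Liu Def. B.2 «strictly unitary») and unramified outside the finite set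
`S`, the product `Z(s) = ∏'_{v ∉ S} [(1 − q_v^{−s})(1 − ψ(ϖ_v) q_v^{−s})]⁻¹` has a genuine pole at
`s = 1` approached from `Re s > 1`: `(s − 1)^k Z(s) → c ≠ 0` for some `k ≥ 1` (in fact `k = 1` if
`ψ ≠ 1` by Hecke–Landau ★ `exists_entire_forall_ne_zero_eq_partialHeckeL`, `k = 2` if `ψ = 1` by
★ `tendsto_sub_one_mul_tprod_eulerFactor_one_numberField`). Instantiated at `K = L`,
`ψ = ν := λᶜ χ̌ λ⁻¹` this is the numerator of the constant-term ratio `r(s)` of `E_Q` (DEPMAP §1b).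
[cite: Liu2021, Thm. B.4 (1)(a), p. 98] [cite: Liu2021, Prop. D.4 (proof), p. 131]
audit: paper:liu2021-fourier-jacobi-cycles-arithmetic-relative-trace-formula p0131.txt:L23 «automorphic character μ of weight one such that L(s, Π ⊗ μ) has a simple pole at s = 1. By Theorem B.4, we have»
size S–M · deps: ★ `PairLFunctionPolesGLOneDedekindProofs.tendsto_sub_one_mul_tprod_eulerFactor_one_numberField`,
★ `PairLFunctionPolesGLOneBoundaryUnconditional.exists_ne_zero_tendsto_partialHeckeL_of_re_eq_one`, Mathlib
`Multipliable` algebra of `tprod` · road S-A and S-B · OWNER: open. -/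
theorem sig_K2LiuThetaTypePartialLPole :
    ∀ (K : Type) [Field K] [NumberField K] (ψ : HeckeCharacter K), ψ.IsUnitary →
      (∀ t : ℝ≥0ˣ, ψ (posRealIdele K t) = 1) →
        ∀ (S : Set (HeightOneSpectrum (𝓞 K))), S.Finite → (∀ v ∉ S, ψ.IsUnramifiedAt v) →
          ∃ (k : ℕ) (c : ℂ), 1 ≤ k ∧ c ≠ 0 ∧
            Tendsto (fun s : ℂ => (s - 1) ^ k *
                ∏' v : {v : HeightOneSpectrum (𝓞 K) // v ∉ S},
                  ((1 - ((v.1.residueCard : ℂ) ^ (-s)))⁻¹ *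
                    (1 - ψ.valueAtUniformizer v.1 * ((v.1.residueCard : ℂ) ^ (-s)))⁻¹))
              (𝓝[{s : ℂ | 1 < s.re}] 1) (𝓝 c) :=
  Summit.HodgeConjecture.HodgeConjecture.Cruxes.HLiu418.K2LiuThetaTypePartialLPole.thetaTypePartialLPole

end Summit.HodgeConjecture.HodgeConjecture.Cruxes.HLiu418.K2LiuCurveThetaSigsU1PoleInput
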